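import Mathlib

/-!
# SoloInformedPencil — uniqueness forces linearity of the GMA diagonal cochain; the pencil of kernels

solo-Langlands-informed, session s23 (2026-08-23), Part II §7.11 (16.10) "THE PENCIL THEOREM".

Abstract core.  `G` is a group (only `*` is used), `R` a commutative ring, `c : G → R` a fixed
1-cochain (the Ribet / `K₂` class `c₀`) and, for each Kummer cochain `κ : G → R` of a unit `η`,
the diagonal entry `a` of a first-order reducible GMA point satisfies the affine equation
`a (g * h) = a g + a h + c g * κ h` together with a linear admissibility (Selmer) condition `a ∈ S`.
If the only admissible additive cochain is `0` (no unramified `ℤ/p`-quotient of the class group: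
`p ∤ h_F`), solutions are unique (`soloInformed_pencilSol_unique`), hence LINEAR in `κ`
(`soloInformed_pencil_linear`): `a_{x₁κ₁+x₂κ₂} = x₁ a₁ + x₂ a₂`.  Evaluating at one common element
`φ` (a Frobenius lift lying in every `G_{F_η}`, which exists because `F_v(ζ_p, U^{1/p})/F_v` is totally
ramified) gives the linear functional `ℓ(x₁,x₂) = x₁ a₁ φ + x₂ a₂ φ` (`soloInformed_pencil_eval`), whose
zero set on the lines of `K²` is ONE line or ALL (`soloInformed_pencil_one_or_all`,
`soloInformed_pencil`): the 'one or all' law for the primes above `v` in the `p+1` Kummer fields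
`F(η^{1/p})`, observed at 624/624 prime rows and 25/25 fields (s23, claims c163–c165).
Sorry-free; `import Mathlib` only.
-/

namespace Summit.Langlands.Langlands.Theorems

section Cochain

variable {G : Type*} [Mul G] {R : Type*} [CommRing R]

/-- `a` solves the diagonal GMA equation for the Kummer cochain `κ` (Ribet cochain `c` fixed)
and satisfies the linear admissibility condition `S`. -/
structure SoloInformedPencilSol (c : G → R) (S : Submodule R (G → R)) (κ a : G → R) : Prop where
  eq : ∀ g h, a (g * h) = a g + a h + c g * κ h
  mem : a ∈ S

/-- The solution relation is jointly linear in `(κ, a)`. -/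
theorem soloInformed_pencilSol_lincomb {c : G → R} {S : Submodule R (G → R)}
    {κ₁ κ₂ a₁ a₂ : G → R} (h₁ : SoloInformedPencilSol c S κ₁ a₁)
    (h₂ : SoloInformedPencilSol c S κ₂ a₂) (x₁ x₂ : R) :
    SoloInformedPencilSol c S (x₁ • κ₁ + x₂ • κ₂) (x₁ • a₁ + x₂ • a₂) := by
  refine ⟨fun g h => ?_, S.add_mem (S.smul_mem x₁ h₁.2) (S.smul_mem x₂ h₂.2)⟩
  simp only [Pi.add_apply, Pi.smul_apply, smul_eq_mul, h₁.1 g h, h₂.1 g h]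
  ring

/-- Uniqueness: if no nonzero additive cochain is admissible, the solution for `κ` is unique. -/
theorem soloInformed_pencilSol_unique {c : G → R} {S : Submodule R (G → R)}
    (huniq : ∀ z : G → R, (∀ g h, z (g * h) = z g + z h) → z ∈ S → z = 0)
    {κ a a' : G → R} (ha : SoloInformedPencilSol c S κ a)
    (ha' : SoloInformedPencilSol c S κ a') : a = a' := by
  have hz : a - a' = 0 := by
    refine huniq (a - a') (fun g h => ?_) (S.sub_mem ha.2 ha'.2)
    simp only [Pi.sub_apply, ha.1 g h, ha'.1 g h]
    ring
  exact sub_eq_zero.mp hz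

/-- LINEARITY: under uniqueness, the solution attached to `x₁ κ₁ + x₂ κ₂` is `x₁ a₁ + x₂ a₂`. -/
theorem soloInformed_pencil_linear {c : G → R} {S : Submodule R (G → R)}
    (huniq : ∀ z : G → R, (∀ g h, z (g * h) = z g + z h) → z ∈ S → z = 0)
    {κ₁ κ₂ a₁ a₂ : G → R} (h₁ : SoloInformedPencilSol c S κ₁ a₁)
    (h₂ : SoloInformedPencilSol c S κ₂ a₂) {x₁ x₂ : R} {a : G → R}
    (h : SoloInformedPencilSol c S (x₁ • κ₁ + x₂ • κ₂) a) :
    a = x₁ • a₁ + x₂ • a₂ :=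
  soloInformed_pencilSol_unique huniq h (soloInformed_pencilSol_lincomb h₁ h₂ x₁ x₂)

/-- Evaluation at a common element `φ` is the linear functional `x₁ a₁ φ + x₂ a₂ φ`. -/
theorem soloInformed_pencil_eval {c : G → R} {S : Submodule R (G → R)}
    (huniq : ∀ z : G → R, (∀ g h, z (g * h) = z g + z h) → z ∈ S → z = 0)
    {κ₁ κ₂ a₁ a₂ : G → R} (h₁ : SoloInformedPencilSol c S κ₁ a₁)
    (h₂ : SoloInformedPencilSol c S κ₂ a₂) {x₁ x₂ : R} {a : G → R}
    (h : SoloInformedPencilSol c S (x₁ • κ₁ + x₂ • κ₂) a) (φ : G) :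
    a φ = x₁ * a₁ φ + x₂ * a₂ φ := by
  rw [soloInformed_pencil_linear huniq h₁ h₂ h]
  simp [Pi.add_apply, Pi.smul_apply, smul_eq_mul]

end Cochain

section Kernel

variable {K : Type*} [Field K]

/-- ONE OR ALL: the zero set of `(x₁,x₂) ↦ x₁ A + x₂ B` on `K²` is everything (`A = B = 0`)
or a single line (any two zeros are proportional). -/
theorem soloInformed_pencil_one_or_all (A B : K) :
    (A = 0 ∧ B = 0) ∨
    ∀ x₁ x₂ y₁ y₂ : K, x₁ * A + x₂ * B = 0 → y₁ * A + y₂ * B = 0 → x₁ * y₂ = x₂ * y₁ := by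
  by_cases hAB : A = 0 ∧ B = 0
  · exact Or.inl hAB
  · refine Or.inr fun x₁ x₂ y₁ y₂ hx hy => ?_
    have eA : A * (x₁ * y₂ - x₂ * y₁) = 0 := by linear_combination y₂ * hx - x₂ * hy
    have eB : B * (x₁ * y₂ - x₂ * y₁) = 0 := by linear_combination x₁ * hy - y₁ * hx
    rcases not_and_or.mp hAB with hA | hB
    · exact sub_eq_zero.mp ((mul_eq_zero.mp eA).resolve_left hA)
    · exact sub_eq_zero.mp ((mul_eq_zero.mp eB).resolve_left hB)

end Kernel

/-- THE PENCIL (abstract form of §7.11 (16.10)).  Under uniqueness, with solutions `a₁, a₂` attached to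
`κ₁, κ₂` and a common evaluation element `φ`: EITHER every solution attached to any `x₁ κ₁ + x₂ κ₂`
vanishes at `φ` ('ALL'), OR two solutions attached to `x₁ κ₁ + x₂ κ₂` and `y₁ κ₁ + y₂ κ₂` that both vanish
at `φ` have proportional labels ('ONE line'). -/
theorem soloInformed_pencil {G : Type*} [Mul G] {K : Type*} [Field K]
    {c : G → K} {S : Submodule K (G → K)}
    (huniq : ∀ z : G → K, (∀ g h, z (g * h) = z g + z h) → z ∈ S → z = 0)
    {κ₁ κ₂ a₁ a₂ : G → K} (h₁ : SoloInformedPencilSol c S κ₁ a₁)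
    (h₂ : SoloInformedPencilSol c S κ₂ a₂) (φ : G) :
    (∀ x₁ x₂ : K, ∀ a : G → K, SoloInformedPencilSol c S (x₁ • κ₁ + x₂ • κ₂) a → a φ = 0) ∨
    (∀ x₁ x₂ y₁ y₂ : K, ∀ a a' : G → K,
      SoloInformedPencilSol c S (x₁ • κ₁ + x₂ • κ₂) a →
      SoloInformedPencilSol c S (y₁ • κ₁ + y₂ • κ₂) a' →
      a φ = 0 → a' φ = 0 → x₁ * y₂ = x₂ * y₁) := by
  rcases soloInformed_pencil_one_or_all (a₁ φ) (a₂ φ) with ⟨hA, hB⟩ | hprop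
  · refine Or.inl fun x₁ x₂ a h => ?_
    rw [soloInformed_pencil_eval huniq h₁ h₂ h φ, hA, hB]
    ring
  · refine Or.inr fun x₁ x₂ y₁ y₂ a a' h h' ha ha' => ?_
    rw [soloInformed_pencil_eval huniq h₁ h₂ h φ] at ha
    rw [soloInformed_pencil_eval huniq h₁ h₂ h' φ] at ha'
    exact hprop x₁ x₂ y₁ y₂ ha ha'

/-- The additivity-on-the-kernel input (cf. `soloInformed_gma_additive_on_ker`, p356450), restated for
this file's relation: on the common zero set of `κ`, a solution is additive — so its restriction to
`G_{F_η} = ker κ_η` is a homomorphism `ψ_η`, and `ψ_η(φ) = a φ` for `φ` in that kernel. -/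
theorem soloInformed_pencilSol_additive_on_ker {G : Type*} [Mul G] {R : Type*} [CommRing R]
    {c : G → R} {S : Submodule R (G → R)} {κ a : G → R} (h : SoloInformedPencilSol c S κ a)
    {g g' : G} (hg' : κ g' = 0) : a (g * g') = a g + a g' := by
  rw [h.1 g g', hg', mul_zero, add_zero]

end Summit.Langlands.Langlands.Theorems
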